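import Literature.NumberTheory.Automorphic.TorusCharacterSplitRigidityLocal           -- ★ `semilocalUnits_piUnits_symm_mulSingle` (+ ★ `TorusCharacterLocalComponents`: `semilocalUnits`, `HeckeCharacter.semilocalComponent`)
import Literature.NumberTheory.GaloisRepresentations.HeckeCharacterWeakApproximation  -- ★ `HeckeCharacter.eq_one_of_forall_localUnits` (`K^× 𝕀_K^S` is dense in `𝕀_K`)
import HarnessLib

/-!
# Rigidity of Hecke characters from their (semi-)local components at the finite places (proof file)

Topic `NumberTheory/Automorphic`; namespaces `Literature.NumberTheory.GaloisRepresentations.HeckeCharacter` (§1) and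
`Literature.NumberTheory.Automorphic.UnitaryGroup` (§2–§3).  Everything here is PROVED (no named fact, no `def`, no instance, no
notation, no `sorry`); it is a short corollary file of the tree's density theorem ★ `HeckeCharacter.eq_one_of_forall_localUnits`
(`GaloisRepresentations/HeckeCharacterWeakApproximation.lean`: a Hecke character trivial on `K_vˣ ↪ 𝕀_K` for all finite `v` outside a
finite `S` is trivial — Cassels–Fröhlich, Ch. VII (Tate) §4 Prop. 4.1, uniqueness: «`K^* J_K^S` is a dense subset of `J_K`», with the weak
approximation theorem Ch. II §6 at the archimedean places) in the two currencies the unitary-group files use: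

* §1 `HeckeCharacter.ext_of_forall_localComponent_eq` — **two Hecke characters of a number field `K` with the same local component
  `χ_v = χ ∘ localUnits v : K_vˣ → ℂˣ` at EVERY finite place `v` are equal** (no condition at the archimedean places is needed: `K^×` is
  dense in `(K ⊗ ℝ)^×`).  [Cassels–Fröhlich VII §4 Prop. 4.1 (proof); Tate's thesis §4.3: a quasi-character of `𝕀_K/K^×` is the product of its
  local components.]
* §2 `localComponent_eq_of_semilocalComponent_eq` — for an extension `E/F` and a finite place `v` of `F`, the block inclusion ★
  `semilocalUnits E v : (∏_{w ∣ v} E_w)ˣ →* 𝕀_E` restricted to the single factor `E_wˣ` (`w ∣ v`) IS the single-place inclusion ★ `localUnits w`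
  (★ `semilocalUnits_piUnits_symm_mulSingle`, `TorusCharacterSplitRigidityLocal`); hence agreement of two Hecke characters of `E` on the semi-local
  component at `v` (★ `HeckeCharacter.semilocalComponent E v`, the `μ`-slot of the CM packet vocabulary) forces agreement of their local components
  at every `w ∣ v`.
* §3 `HeckeCharacter.eq_of_forall_semilocalComponent_eq` — **two Hecke characters of `E` with the same semi-local component at every
  finite place `v` of `F` are equal** (every finite place `w` of `E` lies over `w.under (𝓞 F)`).  This is the form the Rogawski∕Gelbart–Rogawski
  letters of cell `hodgecm-mathlib` carry their dictionary hypothesis in («DICT1»: `∀ v, (toHeckeCharacter L μ).semilocalComponent L v =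
  (ξ.bcη⁻¹ * ξ.bcψ⁻¹ * μω).semilocalComponent L v`, e.g. ★ `Rogawski1990/CMThetaDockingClauses.lean`, ★ `GelbartRogawski1991/PiSCompletionIsThetaType.lean`),
  and it upgrades that hypothesis to the GLOBAL identity `toHeckeCharacter L μ = ξ.bcη⁻¹ * ξ.bcψ⁻¹ * μω` consumed by ★
  `F0P2uS2SharpTheta.memXiFamily_of_theta_of_clauses` ∕ ★ `F0P2uXiOfThetaDatum` (line LH10 of crux H413, LH10-plan (g0) deal (c), 2026-09-02).

## References
* J. W. S. Cassels, A. Fröhlich (eds.), *Algebraic Number Theory* (1967): Ch. II (Cassels) §6 (weak approximation); Ch. VII (Tate) §3.2, §4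
  Prop. 4.1 and its proof («`K^* J_K^S` is dense in `J_K`»). [CasselsFrohlichANT1967]
* J. Tate, *Fourier analysis in number fields and Hecke's zeta-functions* (thesis 1950, in Cassels–Fröhlich 1967), §3.2 (local embeddings
  `K_vˣ → 𝕀_K`), §4.3 (quasi-characters of the idele class group and their local components). [TateThesis1967]
-/

set_option autoImplicit false

noncomputable section

open NumberField IsDedekindDomain

/-! ## §1 A Hecke character is determined by its local components at the finite places -/

namespace Literature.NumberTheory.GaloisRepresentations.HeckeCharacter

variable {K : Type*} [Field K] [NumberField K]

/-- **Rigidity from the finite local components**: two Hecke characters `χ₁, χ₂ : 𝕀_K/K^× → ℂˣ` with `χ₁ ∘ localUnits v = χ₂ ∘ localUnits v`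
for EVERY finite place `v` coincide.  Proof: `χ₁ χ₂⁻¹` is trivial on every `K_vˣ ↪ 𝕀_K`, hence trivial by ★ `eq_one_of_forall_localUnits` with
`S = ∅` (density of `K^× 𝕀_{K,f}` in `𝕀_K`, i.e. of `K^×` in `(K ⊗_ℚ ℝ)^×`). [cite: CasselsFrohlichANT1967, Ch. VII §4 Prop. 4.1 (proof)] [cite: TateThesis1967, §4.3] -/
theorem ext_of_forall_localComponent_eq {χ₁ χ₂ : HeckeCharacter K}
    (h : ∀ (v : HeightOneSpectrum (𝓞 K)) (u : (v.adicCompletion K)ˣ), χ₁.localComponent v u = χ₂.localComponent v u) :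
    χ₁ = χ₂ := by
  have h1 : χ₁ * χ₂⁻¹ = 1 := by
    refine eq_one_of_forall_localUnits (S := (∅ : Finset (HeightOneSpectrum (𝓞 K)))) fun v _ u => ?_
    have hv := h v u
    simp only [localComponent_apply] at hv
    rw [mul_apply, inv_apply, hv, mul_inv_cancel]
  exact mul_inv_eq_one.1 h1

/-- The same, with the hypothesis stated as equality of the local component homomorphisms `χ₁.localComponent v = χ₂.localComponent v`.
[cite: CasselsFrohlichANT1967, Ch. VII §4 Prop. 4.1 (proof)] -/
theorem ext_of_forall_localComponent_eq' {χ₁ χ₂ : HeckeCharacter K}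
    (h : ∀ v : HeightOneSpectrum (𝓞 K), χ₁.localComponent v = χ₂.localComponent v) : χ₁ = χ₂ :=
  ext_of_forall_localComponent_eq fun v u => by rw [h v]

end Literature.NumberTheory.GaloisRepresentations.HeckeCharacter

/-! ## §2 Semi-local agreement at `v` ⇒ local agreement at every place above `v` -/

namespace Literature.NumberTheory.Automorphic.UnitaryGroup

open Literature.NumberTheory.GaloisRepresentations

variable {F : Type} (E : Type) [Field F] [NumberField F] [Field E] [NumberField E] [Algebra F E]
  {v : HeightOneSpectrum (𝓞 F)}

/-- **Semi-local agreement forces local agreement above `v`**: if two Hecke characters of `E` have the same semi-local component at the finite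
place `v` of `F` (★ `HeckeCharacter.semilocalComponent E v` on `(∏_{w ∣ v} E_w)ˣ`), then their local components agree at every place `w ∣ v` of `E` (test on the semi-local unit with component `x` at `w` and `1` elsewhere: ★
`semilocalUnits_piUnits_symm_mulSingle`). [cite: TateThesis1967, §3.2, §4.3] -/
theorem localComponent_eq_of_semilocalComponent_eq {χ₁ χ₂ : HeckeCharacter E}
    (h : χ₁.semilocalComponent E v = χ₂.semilocalComponent E v) (w : PlacesOver E v) (x : (w.1.adicCompletion E)ˣ) :
    χ₁.localComponent w.1 x = χ₂.localComponent w.1 x := by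
  classical
  have hx := congrArg
    (fun f : (LocalRing E v)ˣ →* ℂˣ =>
      f ((MulEquiv.piUnits (M := fun w' : PlacesOver E v => w'.1.adicCompletion E)).symm (Pi.mulSingle w x))) h
  simp only [semilocalComponent_apply, semilocalUnits_piUnits_symm_mulSingle] at hx
  rw [HeckeCharacter.localComponent_apply, HeckeCharacter.localComponent_apply]
  exact hx

/-! ## §3 A Hecke character of `E` is determined by its semi-local components at the finite places of `F` -/

/-- **Rigidity from the semi-local components**: two Hecke characters `χ₁, χ₂` of `E` with `χ₁.semilocalComponent E v = χ₂.semilocalComponent E v`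
for EVERY finite place `v` of `F` are equal — every finite place `w` of `E` lies over `v = w ∩ 𝓞 F` (`w.under (𝓞 F)`), so §2 gives equal local
components everywhere and §1 (density of `E^×` in `(E ⊗ ℝ)^×`, ★ `eq_one_of_forall_localUnits`) concludes.  This upgrades the letters' semi-local
dictionary hypothesis «`∀ v, χ₁.semilocalComponent E v = χ₂.semilocalComponent E v`» to the global identity `χ₁ = χ₂`.
[cite: CasselsFrohlichANT1967, Ch. VII §4 Prop. 4.1 (proof)] [cite: TateThesis1967, §4.3] -/
theorem _root_.Literature.NumberTheory.GaloisRepresentations.HeckeCharacter.eq_of_forall_semilocalComponent_eq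
    {χ₁ χ₂ : HeckeCharacter E}
    (h : ∀ v : HeightOneSpectrum (𝓞 F), χ₁.semilocalComponent E v = χ₂.semilocalComponent E v) : χ₁ = χ₂ :=
  HeckeCharacter.ext_of_forall_localComponent_eq fun w x =>
    localComponent_eq_of_semilocalComponent_eq E (h (w.under (𝓞 F))) ⟨w, rfl⟩ x

end Literature.NumberTheory.Automorphic.UnitaryGroup

end
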